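import Summits.Ventures.Crystal3D.Theorems.StickyWulffConstantPolycrystalWulffBoundRungZone
import Summits.Ventures.Crystal3D.Theorems.StickyWulffConstantNoReconstructionGainCubicActions

/-!
# `PolycrystalWulffBound`, line `PolyDensity`: the zone rung in TEXTURE form — single-axis twin
# textures of the `⟨112⟩` zones satisfy the polycrystal Wulff bound (crux energy, law `(1, 1/2)`)

Route `StickyWulffConstant` of the venture `Summits/Ventures/Crystal3D`, crux `PolycrystalWulffBound`
(item `stmt-Ventures-19482`), second prover lane (poly-p2, gen 8).  `rung_zone` (`…RungZone`) bounds the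
FREE energy of zone textures under the abstract hypothesis «`u` is a mirror normal of every grain's
lattice».  Here:
* `map_reflection_orthogonal_unit_eq` — conjugating a bond mirror by a frame;
* `reflection_image_lattice_eq_of_mem` — for ANY orientation `A`, every unit vector `u` of the lattice
  `A '' Λ₀` (a nearest-neighbour bond) is a mirror normal: `R_u '' (A '' Λ₀) = A '' Λ₀` (the wall lane's
  `latticeIsometry_bondReflection`);
* **`rung_zone_texture`** — in the crux's own vocabulary (`Tex`, `En`, law `(1, 1/2)`, arbitrary wall
  data `c, m`): a polyhedral texture whose frames pairwise satisfy `Ax m₀`, with a common horizontal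
  nearest-neighbour bond `u` (`u ∈ A_f Λ₀`, `‖u‖ = 1`, `u ⊥ m₀`) and `w ⊥ m₀, u`, such that no line parallel
  to `w` meets two grains with different lattices (every twin wall contains `w`: for fcc twins about
  `[111]` this is the `⟨11-2⟩` ZONE — `(111)`, `{1-10}`, `{201}`, `{021}`, `{312}`, …, mixed freely),
  satisfies `6·2^{1/3}(√2·Vol)^{2/3} ≤ En`.  The wall terms are only used through their sign.
WHAT THIS IS NOT: a registered stub; other zones / multi-axis textures; the crux is not claimed.
-/

noncomputable section

open scoped BigOperators InnerProductSpace ENNReal Pointwise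
open MeasureTheory Filter Set

namespace Summit.Ventures.Crystal3D.Theorems

open Summit.Ventures.Crystal3D.Cruxes.TextureLiminf.TexShadow (E3)
open Literature.MathematicalPhysics.StatisticalMechanics (fccStacking barlowStacking IsHaggSeq)

/-- Conjugating the mirror across `(ℝ∙p)ᗮ` (`‖p‖ = 1`) by a linear isometry `L`: `L ∘ R_p = R_{Lp} ∘ L`. -/
theorem map_reflection_orthogonal_unit_eq (L : E3 ≃ₗᵢ[ℝ] E3) {p : E3} (hp : ‖p‖ = 1) (x : E3) :
    L ((ℝ ∙ p)ᗮ.reflection x) = (ℝ ∙ L p)ᗮ.reflection (L x) := by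
  have hLp : ‖L p‖ = 1 := by rw [LinearIsometryEquiv.norm_map, hp]
  rw [reflection_orthogonal_unit_apply hp, reflection_orthogonal_unit_apply hLp, map_sub, map_smul,
    LinearIsometryEquiv.inner_map_map]

/-- **Every nearest-neighbour bond of a grain is a mirror normal of its lattice**: for any orientation
`A` and any unit vector `u ∈ A '' Λ₀`, `R_u '' (A '' Λ₀) = A '' Λ₀`. -/
theorem reflection_image_lattice_eq_of_mem {A : E3 ≃ₗᵢ[ℝ] E3} {u : E3}
    (hu : u ∈ A '' fccStacking 1 (Real.sqrt (2 / 3))) (hu1 : ‖u‖ = 1) :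
    (ℝ ∙ u)ᗮ.reflection '' (A '' fccStacking 1 (Real.sqrt (2 / 3))) = A '' fccStacking 1 (Real.sqrt (2 / 3)) := by
  obtain ⟨p, hp, rfl⟩ := hu
  have hp1 : ‖p‖ = 1 := by rw [← hu1, LinearIsometryEquiv.norm_map]
  obtain ⟨h₁, -⟩ := latticeIsometry_bondReflection hp hp1
  ext y
  constructor
  · rintro ⟨_, ⟨x, hx, rfl⟩, rfl⟩
    rw [← map_reflection_orthogonal_unit_eq A hp1]
    exact ⟨_, h₁ x hx, rfl⟩
  · rintro ⟨x, hx, rfl⟩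
    refine ⟨A ((ℝ ∙ p)ᗮ.reflection x), ⟨_, h₁ x hx, rfl⟩, ?_⟩
    rw [← map_reflection_orthogonal_unit_eq A hp1, Submodule.reflection_reflection]

end Summit.Ventures.Crystal3D.Theorems

namespace Summit.Ventures.Crystal3D.Cruxes.PolycrystalWulffBound.PolyDensity

open Summit.Ventures.Crystal3D.Theorems
open Summit.Ventures.Crystal3D.Cruxes.TextureLiminf.TexShadow (per polytope E3)
open Literature.MathematicalPhysics.StatisticalMechanics (fccStacking barlowStacking IsHaggSeq perimeter)

/-- **Rung `rung_zone_texture`**: zone twin textures (single axis `m₀`, common horizontal bond `u`,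
every twin wall containing `w ⊥ m₀, u`) satisfy the crux's inequality `6·2^{1/3}(√2·Vol)^{2/3} ≤ En`
for arbitrary wall data. -/
theorem rung_zone_texture :
    let Λ : Set (EuclideanSpace ℝ (Fin 3)) := Literature.MathematicalPhysics.StatisticalMechanics.fccStacking 1 (Real.sqrt (2 / 3));
    let Brl : (ℤ → ℤ) → Set (EuclideanSpace ℝ (Fin 3)) := Literature.MathematicalPhysics.StatisticalMechanics.barlowStacking 1 (Real.sqrt (2 / 3));
    let Ax : EuclideanSpace ℝ (Fin 3) → (EuclideanSpace ℝ (Fin 3) ≃ₗᵢ[ℝ] EuclideanSpace ℝ (Fin 3)) → (EuclideanSpace ℝ (Fin 3) ≃ₗᵢ[ℝ] EuclideanSpace ℝ (Fin 3)) → Prop := fun m A B => ∃ (L : EuclideanSpace ℝ (Fin 3) ≃ₗᵢ[ℝ] EuclideanSpace ℝ (Fin 3)) (s₁ s₂ : EuclideanSpace ℝ (Fin 3)) (σ σ' : ℤ → ℤ), Literature.MathematicalPhysics.StatisticalMechanics.IsHaggSeq σ ∧ Literature.MathematicalPhysics.StatisticalMechanics.IsHaggSeq σ' ∧ L (EuclideanSpace.single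 (2 : Fin 3) (1 : ℝ)) = m ∧ A '' Λ ⊆ (fun q => L q + s₁) '' Brl σ ∧ B '' Λ ⊆ (fun q => L q + s₂) '' Brl σ';
    let CoAx : (EuclideanSpace ℝ (Fin 3) ≃ₗᵢ[ℝ] EuclideanSpace ℝ (Fin 3)) → (EuclideanSpace ℝ (Fin 3) ≃ₗᵢ[ℝ] EuclideanSpace ℝ (Fin 3)) → Prop := fun A B => ∃ m, Ax m A B;
    let Φ : EuclideanSpace ℝ (Fin 3) → ℝ := fun ν => Real.sqrt 2 / 4 * ∑ᶠ w ∈ {w ∈ Λ | ‖w‖ = 1}, |⟪w, ν⟫_ℝ|;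
    let Per : Set (EuclideanSpace ℝ (Fin 3)) → Set (EuclideanSpace ℝ (Fin 3)) → ℝ := fun K S => (⨆ (ξ : EuclideanSpace ℝ (Fin 3) → EuclideanSpace ℝ (Fin 3)) (_ : ContDiff ℝ 1 ξ ∧ HasCompactSupport ξ ∧ ∀ z, ξ z ∈ K), ENNReal.ofReal (∫ z in S, Literature.MathematicalPhysics.StatisticalMechanics.fieldDivergence ξ z)).toReal;
    let ι : Set (EuclideanSpace ℝ (Fin 3)) → Set (EuclideanSpace ℝ (Fin 3)) → Set (EuclideanSpace ℝ (Fin 3)) → ℝ := fun K S₁ S₂ => (Per K S₁ + Per K S₂ - Per K (S₁ ∪ S₂)) / 2;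
    let W : (EuclideanSpace ℝ (Fin 3) ≃ₗᵢ[ℝ] EuclideanSpace ℝ (Fin 3)) → Set (EuclideanSpace ℝ (Fin 3)) := fun A => {y | ∀ ν : EuclideanSpace ℝ (Fin 3), ⟪y, ν⟫_ℝ ≤ Φ (A.symm ν)};
    let Dsc : EuclideanSpace ℝ (Fin 3) → Set (EuclideanSpace ℝ (Fin 3)) := fun m => {y | ‖y‖ ≤ 1 ∧ ⟪y, m⟫_ℝ = 0};
    let Tex : (n : ℕ) → (Fin n → Set (EuclideanSpace ℝ (Fin 3))) → (Fin n → (EuclideanSpace ℝ (Fin 3) ≃ₗᵢ[ℝ] EuclideanSpace ℝ (Fin 3))) → (Fin n → Fin n → ℝ) → (Fin n → Fin n → EuclideanSpace ℝ (Fin 3)) → Prop := fun n G A c m => (∀ f : Fin n, Literature.MathematicalPhysics.StatisticalMechanics.HasFinitePerimeter (G f) ∧ volume (G f) < ⊤) ∧ (∀ f g, f ≠ g → Disjoint (G f) (G g)) ∧ (∀ f g, f ≠ g → 0 ≤ c f g) ∧ (∀ f g, f ≠ g → ¬ CoAx (A f) (A g) → m f g = 0 ∧ 1 ≤ c f g)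 ∧ (∀ f g, f ≠ g → CoAx (A f) (A g) → A f '' Λ ≠ A g '' Λ → Ax (m f g) (A f) (A g) ∧ 1 / 2 ≤ c f g);
    let En : (n : ℕ) → (Fin n → Set (EuclideanSpace ℝ (Fin 3))) → (Fin n → (EuclideanSpace ℝ (Fin 3) ≃ₗᵢ[ℝ] EuclideanSpace ℝ (Fin 3))) → (Fin n → Fin n → ℝ) → (Fin n → Fin n → EuclideanSpace ℝ (Fin 3)) → ℝ := fun n G A c m => ∑ f : Fin n, Per (W (A f)) (G f) - ∑ f, ∑ g, (if f = g then 0 else ι (W (A f)) (G f) (G g)) + ∑ f, ∑ g, (if f = g then 0 else c f g / 2 * ι (Dsc (m f g)) (G f) (G g));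
    let Vol : (n : ℕ) → (Fin n → Set (EuclideanSpace ℝ (Fin 3))) → ℝ := fun n G => (volume (⋃ f : Fin n, G f)).toReal;
    let Poly : Set (EuclideanSpace ℝ (Fin 3)) → Prop := fun S => ∃ (k : ℕ) (H : Fin k → Finset ((EuclideanSpace ℝ (Fin 3)) × ℝ)), S = ⋃ i, ⋂ p ∈ H i, {x | ⟪p.1, x⟫_ℝ < p.2};
    ∀ (n : ℕ) (G : Fin n → Set (EuclideanSpace ℝ (Fin 3))) (A : Fin n → (EuclideanSpace ℝ (Fin 3) ≃ₗᵢ[ℝ] EuclideanSpace ℝ (Fin 3))) (c : Fin n → Fin n → ℝ) (m : Fin n → Fin n → EuclideanSpace ℝ (Fin 3)), Tex n G A c m → (∀ f, Poly (G f)) → ∀ (m₀ u w : EuclideanSpace ℝ (Fin 3)), (∀ f g, Ax m₀ (A f) (A g)) → ‖u‖ = 1 → ‖w‖ = 1 → ⟪u, m₀⟫_ℝ = 0 → ⟪w, m₀⟫_ℝ = 0 → ⟪w, u⟫_ℝ = 0 → (∀ f, u ∈ A f '' Λ) → (∀ f g, ∀ x ∈ G f, ∀ t : ℝ, x + t • w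 ∈ G g → A f '' Λ = A g '' Λ) → 6 * (2 : ℝ) ^ ((1 : ℝ) / 3) * (Real.sqrt 2 * Vol n G) ^ ((2 : ℝ) / 3) ≤ En n G A c m := by
  intro Λ Brl Ax CoAx Φ Per ι W Dsc Tex En Vol Poly n G A c m hTex hPoly m₀ u w hAx hu hw hum hwm hwu
    humem hzone
  obtain ⟨hfin, hdisj, hc0, -, -⟩ := hTex
  have hvol : ∀ f, volume (G f) < ⊤ := fun f => (hfin f).2
  have hDc : ∀ v : E3, IsCompact (Dsc v) := fun v =>
    Metric.isCompact_of_isClosed_isBounded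
      ((isClosed_le continuous_norm continuous_const).inter
        (isClosed_eq (continuous_id.inner continuous_const) continuous_const))
      (Metric.isBounded_closedBall.subset (cruxDisc_subset_closedBall v))
  -- the wall terms are nonnegative
  have hwalls : 0 ≤ ∑ f, ∑ g, (if f = g then 0 else c f g / 2 * ι (Dsc (m f g)) (G f) (G g)) := by
    refine Finset.sum_nonneg fun f _ => Finset.sum_nonneg fun g _ => ?_
    by_cases hfg : f = g
    · rw [if_pos hfg]
    · rw [if_neg hfg]
      have hnn := iota_nonneg_of_poly G hPoly hvol hdisj (hDc (m f g)) (convex_cruxDisc (m f g))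
        (zero_mem_cruxDisc (m f g)) hfg
      show 0 ≤ c f g / 2 * ((per (Dsc (m f g)) (G f) + per (Dsc (m f g)) (G g) -
        per (Dsc (m f g)) (G f ∪ G g)) / 2)
      exact mul_nonneg (div_nonneg (hc0 f g hfg) zero_le_two) (div_nonneg hnn zero_le_two)
  -- the mirror hypothesis of `rung_zone`
  have hmir : ∀ f, (ℝ ∙ u)ᗮ.reflection '' (A f '' Λ) = A f '' Λ :=
    fun f => reflection_image_lattice_eq_of_mem (humem f) hu
  -- the free-energy rung
  have hFr : 6 * (2 : ℝ) ^ ((1 : ℝ) / 3) * (Real.sqrt 2 * Vol n G) ^ ((2 : ℝ) / 3) ≤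
      ∑ f, Per (W (A f)) (G f) - ∑ f, ∑ g, (if f = g then 0 else ι (W (A f)) (G f) (G g)) :=
    rung_zone n G A m₀ u w hPoly hvol hdisj hAx hu hw hum hwm hwu hmir hzone
  show 6 * (2 : ℝ) ^ ((1 : ℝ) / 3) * (Real.sqrt 2 * Vol n G) ^ ((2 : ℝ) / 3) ≤
    ∑ f, Per (W (A f)) (G f) - ∑ f, ∑ g, (if f = g then 0 else ι (W (A f)) (G f) (G g)) +
      ∑ f, ∑ g, (if f = g then 0 else c f g / 2 * ι (Dsc (m f g)) (G f) (G g))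
  linarith

end Summit.Ventures.Crystal3D.Cruxes.PolycrystalWulffBound.PolyDensity

end
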